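/-
Origin: expansion seat `planner-pub-hodgecm-qw8b-g6-0`, handover NEW (additive leaf; imports ONLY landed r27 `HodgeCM.StubTree.Qw8NoN4`; no rewrite; independent of all RUN-28/29 rows) ; any order (`HOME/pub-hodgecm-qw8b-g6/lean/Qw8b6/Qw8MilnePosNoH0.lean`, md5 3d16333a, 476 lines);
landed by the gen-8 packager in gate run 29 as `HodgeCM/StubTree/Qw8MilnePosNoH0.lean` (verbatim).
-/
/-
Copyright: pub-hodgecm formalisation cell (harness21, 2026). New file (not vendored).
Origin: HOME/pub-hodgecm-qw8b-g6/lean/Qw8b6/Qw8MilnePosNoH0.lean — session planner-pub-hodgecm-qw8b-g6-0 (unit pub-hodgecm-qw8b-g6,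
QW8 SEAT 2, part (6b)(ii), generation 6), fourth file.  WIP module `Qw8b6.Qw8MilnePosNoH0`; intended final place
`HodgeCM/StubTree/Qw8MilnePosNoH0.lean` (module `HodgeCM.StubTree.Qw8MilnePosNoH0`).  ADDITIVE LEAF: replaces nothing,
nothing imports it.  Imports ONLY the landed run-27 module `HodgeCM.StubTree.Qw8NoN4` (qw8b-g5); nothing to rewrite.
-/
import Summits.HodgeConjecture.HodgeCM.StubTree.Qw8NoN4

/-!
# The positive-degree halves of [QW8] Thm 2.5 (sufficiency) and of Gao–Ullmo Thm 3.1 (Pohlmann) need NO degree-zero input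

`Universe.Qw8MilnePos` — "on a CM product `A′ = ∏_j A_{(F,Θ_j)}` (Galois CM field `F`), every weight vector of
POSITIVE degree `2p` whose Lefschetz character vanishes is algebraic" — is a theorem of

  `ModelAxioms` (M1–M28) + N1 `Fact_cupExterior` + N2 `Fact_cup_hodge` + F4 `Fact_cupAlg` + F5 `Fact_cupAssoc`

(`qw8MilnePos_of_facts₅`): no N3 `Fact_pull_H0`, no N3-at-CM-products `Fact_pull_H0_cmProd`, no F-H0 `Fact_unitH0`,
no N4 `Fact_hodge_F0`, no M42 `Fact_H0_rank`.  Compare the landed `qw8MilnePos_of_facts₃ (M) (hN1) (hN2) (hN3) (h4) (h5)`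
(StubTree/Qw8NoN4.lean, run 27) and this seat's `qw8MilnePos_of_facts₄ (…) (h3 : Fact_pull_H0_cmProd) (…)` /
`qw8MilnePos_of_unitH0` (StubTree/Qw8NoN3.lean, run 28): there the degree-0 fact enters ONLY through M29
`Fact_weightSpan` = "weight spaces span `H^k(A′, ℂ)` for EVERY `k`", whose case `k = 0` is the one place N3 is used
(`iSup_weightSpace_zero`), while the consumer — Pohlmann's `⊇` inclusion behind the pair lemma
`cupC_fvec_mem_algC_of_weightHodgeAt` — reads M29 in degree `2 = 2·1` only, where it is a theorem of `ModelAxioms` + N1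
(`iSup_weightSpace_succ`, WeightSpan.lean:230).  This file localises M29 to one degree exactly as pohl-g9 / toy2-g5
localised M30 (`Fact_weightHodgeAt`, PohlmannNoN4.lean:58):

* §1 `Universe.Fact_weightSpanAt k` (M29 in degree `k`), `fact_weightSpanAt_of_weightSpan`, `fact_weightSpanAt_succ (M) (hN1) k :
  Fact_weightSpanAt (k+1)`; the three eigenspace lemmas of `Proofs/PohlmannSpan.lean` §Weights with the localised
  hypothesis: `iSup_eigenspace_eq_top_at`, `eigenspace_eq_weightSpace_at`, `exists_sepVal_eq_at`.
* §2 `weightSpace_le_baseChange_hodgeClassesOf_C_at (h29 : Fact_weightSpanAt (2p)) (h30 : Fact_weightHodgeAt (2p))` — pohl-g9's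
  `weightSpace_le_baseChange_hodgeClassesOf_C_of_weightHodgeAt` (AnyCMFieldNoN4.lean:115–195) VERBATIM with the three lemma
  calls swapped (M29 and M30 both in degree `2p` only; any CM field).
* §2 also: the `⊆` chain with M29 in degree `2p` only — `baseChange_hodgeClassesOf_le_at`, `meets_iff_isRoot_at`,
  `meets_permWeight_galTOf_at`, `isHodgeWeightC_of_meets_at`, `baseChange_hodgeClassesOf_le_iSupC_at`, `baseChange_hodgeClassesOf_eq_iSupC_at`.
* §3 `cupC_fvec_mem_algC_at` — qw8b-g5's pair lemma verbatim over §2; §4 `weightSpace_le_algC_of_lefChar_eq_zero₅`,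
  **`qw8MilnePos_of_facts₅ (M) (hN1) (hN2) (h4) (h5) : U.Qw8MilnePos`** — the landed proofs verbatim with
  `h29 := fact_weightSpanAt_succ M hN1 1`, `h30 := weightHodgeAt_succ_of_facts M hN1 hN2 1`.

* §5 **`pohlmannTheorem31CM_of_facts₅ (M) (hN1) (hN2) : U.PohlmannTheorem31CM`**, `pohlmannTheorem31_of_facts₅` — Gao–Ullmo Thm 3.1
  (Pohlmann), both sentences, EVERY POSITIVE LEVEL, any CM field, from `ModelAxioms` + N1 + N2 ONLY (was `… + N3`, `pohlmannTheorem31CM_of_facts₃`);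
  `baseChange_hodgeClassesOf_eq_iSupC_succ_of_facts₅`, `pohlmannSpanCMAt_succ_of_facts₅`.

Reading (input tables): the degree-0 facts of the [QW8] side (F-H0 = M43 on route (δ); N3-at-CM-products on route (γ))
are consumed by the degree-ZERO half `Qw8MilneZero` and by the Gysin descent ONLY; the positive-degree half is
H⁰-free.  No FACTS row, no input, no frozen statement touched.  Lean + Mathlib axioms only; nothing cited as a hypothesis.
-/

noncomputable section

open scoped TensorProduct NumberField BigOperators Classical
open Polynomial

namespace HodgeCM

open Literature.AlgebraicGeometry.Motives (CMType HodgeStructure)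
open Literature.AlgebraicGeometry.Motives.HodgeStructure (ofRat ofRat_apply)
open HodgeCM.Pohlmann HodgeCM.GaoUllmo HodgeCM.CMTypeOps

namespace Universe

variable {U : Universe}

/-! ## §1 M29 in one degree and the eigenspace lemmas -/

/-- **M29 in one degree `k`**: the weight spaces span `H^k(A′, ℂ)` for every CM product `A′`. -/
def Fact_weightSpanAt (U : Universe) (k : ℕ) : Prop :=
  ∀ (F : CMField) (n : ℕ) (Θ : Fin (n + 1) → CMType F), ⨆ S, U.weightSpace F Θ S k = ⊤

/-- (Ported verbatim from the HodgeCMPerL package; no docstring in the source.) -/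
theorem fact_weightSpanAt_of_weightSpan (h29 : U.Fact_weightSpan) (k : ℕ) : U.Fact_weightSpanAt k :=
  fun F n Θ => h29 F n Θ k

/-- (Ported verbatim from the HodgeCMPerL package; no docstring in the source.) -/
theorem weightSpan_of_weightSpanAt (h : ∀ k, U.Fact_weightSpanAt k) : U.Fact_weightSpan :=
  fun F n Θ k => h k F n Θ

/-- M29 in every POSITIVE degree is a theorem of `ModelAxioms` + N1 (`iSup_weightSpace_succ`). -/
theorem fact_weightSpanAt_succ (M : U.ModelAxioms) (hN1 : U.Fact_cupExterior) (k : ℕ) :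
    U.Fact_weightSpanAt (k + 1) :=
  fun _ _ _ => iSup_weightSpace_succ M hN1 k

section Weights

variable {F : CMField} {n : ℕ} {Θ : Fin (n + 1) → CMType F} {ι : Type} [Fintype ι]
  {j : ι → Fin (n + 1)} {a : ι → 𝓞 F} {c : ι → ℕ} {Mi : ι → U.Mor (U.cmProd F Θ) (U.cmProd F Θ)} {k : ℕ}

/-- The eigenspaces of `T_ℂ` exhaust `H^k(A′, ℂ)` — M29 in degree `k` only (cf. `iSup_eigenspace_eq_top`). -/
theorem iSup_eigenspace_eq_top_at (h29 : U.Fact_weightSpanAt k)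
    (hM : ∀ i, U.IsFactorAct F Θ (j i) (a i : F) (Mi i)) :
    ⨆ μ, Module.End.eigenspace ((U.sepOp c Mi k).baseChange ℂ) μ = ⊤ := by
  refine top_le_iff.mp ?_
  rw [← h29 F n Θ]
  exact iSup_le fun S => le_iSup_of_le (sepVal j a c S) (weightSpace_le_eigenspace hM k S)

/-- With `λ` injective, the `λ(S)`-eigenspace of `T_ℂ` is the weight space of `S` — M29 in degree `k` only. -/
theorem eigenspace_eq_weightSpace_at (h29 : U.Fact_weightSpanAt k)
    (hM : ∀ i, U.IsFactorAct F Θ (j i) (a i : F) (Mi i)) (hinj : Function.Injective (sepVal j a c))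
    (S : Fin (n + 1) → Finset ((F : Type) →+* ℂ)) :
    Module.End.eigenspace ((U.sepOp c Mi k).baseChange ℂ) (sepVal j a c S) = U.weightSpace F Θ S k :=
  eq_of_iSupIndep_of_iSup_eq_top (Module.End.eigenspaces_iSupIndep _) hinj
    (weightSpace_le_eigenspace hM k) (h29 F n Θ) S

/-- Every eigenvalue of `T_ℂ` is a `λ(S)` — M29 in degree `k` only. -/
theorem exists_sepVal_eq_at (h29 : U.Fact_weightSpanAt k)
    (hM : ∀ i, U.IsFactorAct F Θ (j i) (a i : F) (Mi i)) {μ : ℂ}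
    (hμ : Module.End.eigenspace ((U.sepOp c Mi k).baseChange ℂ) μ ≠ ⊥) :
    ∃ S : Fin (n + 1) → Finset ((F : Type) →+* ℂ), sepVal j a c S = μ :=
  exists_of_iSupIndep_of_ne_bot (Module.End.eigenspaces_iSupIndep _) (sepVal j a c)
    (weightSpace_le_eigenspace hM k) (h29 F n Θ) hμ

end Weights

/-! ## §2 Pohlmann's `⊇` with M29 AND M30 in degree `2p` only (any CM field) -/

section AnyF

variable {F : CMField} {n : ℕ} {Θ : Fin (n + 1) → CMType F} {ι : Type} [Fintype ι]
  {j : ι → Fin (n + 1)} {a : ι → 𝓞 F} {c : ι → ℕ} {Mi : ι → U.Mor (U.cmProd F Θ) (U.cmProd F Θ)}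

/-- **`⊇` for any CM field, M29 and M30 in degree `2p` only**: the weight space of a Galois-closure Hodge weight lies in
`B^p(A′) ⊗ ℂ` — the proof of `weightSpace_le_baseChange_hodgeClassesOf_C_of_weightHodgeAt` (AnyCMFieldNoN4.lean) verbatim,
with `iSup_eigenspace_eq_top_at` / `exists_sepVal_eq_at` / `eigenspace_eq_weightSpace_at`. -/
theorem weightSpace_le_baseChange_hodgeClassesOf_C_at {p : ℕ} (h29 : U.Fact_weightSpanAt (2 * p))
    (h30 : U.Fact_weightHodgeAt (2 * p))
    (hM : ∀ i, U.IsFactorAct F Θ (j i) (a i : F) (Mi i))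
    (hinj : Function.Injective (sepVal j a c)) {S : Fin (n + 1) → Finset ((F : Type) →+* ℂ)}
    (hS : IsHodgeWeightC Θ p S) :
    U.weightSpace F Θ S (2 * p) ≤ (U.hodgeClassesOf (U.cmProd F Θ) p).baseChange ℂ := by
  classical
  -- `λ(S) = y ∈ E^c`, `χ = minpoly y`, `Q = χ(T)`
  obtain ⟨y, hy, -, hPy⟩ := exists_sepVal_eq_closure j a c S
  set T : U.Coh (U.cmProd F Θ) (2 * p) →ₗ[ℚ] U.Coh (U.cmProd F Θ) (2 * p) := U.sepOp c Mi (2 * p) with hT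
  set χ : ℚ[X] := minpoly ℚ y with hχ
  set Q : U.Coh (U.cmProd F Θ) (2 * p) →ₗ[ℚ] U.Coh (U.cmProd F Θ) (2 * p) := aeval T χ with hQ
  have hQC : Q.baseChange ℂ = aeval (T.baseChange ℂ) (χ.map (algebraMap ℚ ℂ)) :=
    baseChange_aeval_map T χ
  -- `ker Q_ℂ` is `T_ℂ`-stable
  set K' : Submodule ℂ (U.CohC (U.cmProd F Θ) (2 * p)) := LinearMap.ker (Q.baseChange ℂ) with hK'
  have hcomm : Commute (T.baseChange ℂ) (Q.baseChange ℂ) := by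
    have h := (commute_X (χ.map (algebraMap ℚ ℂ))).map (aeval (T.baseChange ℂ))
    rwa [aeval_X, ← hQC] at h
  have hK'stab : ∀ z ∈ K', T.baseChange ℂ z ∈ K' := by
    intro z hz
    rw [hK', LinearMap.mem_ker] at hz ⊢
    rw [← Module.End.mul_apply, ← hcomm.eq, Module.End.mul_apply, hz, map_zero]
  -- `ker Q_ℂ ⊆ H^{p,p}`
  have hK'le : K' ≤ (U.hodge (U.cmProd F Θ) (2 * p)).piece p p := by
    have hdec : K' = ⨆ μ, K' ⊓ Module.End.eigenspace (T.baseChange ℂ) μ := by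
      have h := Submodule.inf_iSup_genEigenspace (p := K') (f := T.baseChange ℂ) hK'stab 1
      rw [iSup_eigenspace_eq_top_at h29 hM, inf_top_eq] at h
      exact h
    refine hdec.le.trans (iSup_le fun μ => ?_)
    by_cases hμ : K' ⊓ Module.End.eigenspace (T.baseChange ℂ) μ = ⊥
    · rw [hμ]; exact bot_le
    obtain ⟨z, hz, hz0⟩ := (Submodule.ne_bot_iff _).mp hμ
    obtain ⟨hzK, hzE⟩ := Submodule.mem_inf.mp hz
    -- `μ` is a root of `χ_ℂ`
    have hroot : (χ.map (algebraMap ℚ ℂ)).eval μ = 0 := by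
      have h1 : Q.baseChange ℂ z = 0 := hzK
      rw [hQC, aeval_apply_of_mem_eigenspace hzE] at h1
      exact (smul_eq_zero.mp h1).resolve_right hz0
    -- `μ = λ(S')`
    have hE : Module.End.eigenspace (T.baseChange ℂ) μ ≠ ⊥ :=
      fun h => hμ (eq_bot_iff.mpr (inf_le_right.trans h.le))
    obtain ⟨S', hS'⟩ := exists_sepVal_eq_at h29 hM hE
    -- NEW STEP: a complex root of `minpoly_ℚ(y)`, `y ∈ E^c`, is `ψ y` for an embedding `ψ : E^c → ℂ`
    have hmem : μ ∈ (minpoly ℚ y).rootSet ℂ := by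
      rw [mem_rootSet]
      refine ⟨minpoly.ne_zero (IsIntegral.of_finite ℚ y), ?_⟩
      rw [aeval_def, ← eval_map]
      exact hroot
    rw [← Algebra.IsAlgebraic.range_eval_eq_rootSet_minpoly] at hmem
    obtain ⟨ψ, hψ⟩ := hmem
    -- the element `σ_ψ ∈ Gal(E^c/ℚ)` carries `S` to `S'`
    have hSS' : permWeight (galTOf (autOfEmb ψ)).1 S = S' := by
      apply hinj
      rw [hPy ψ, hS']
      exact hψ
    -- conclude with M30 for the Galois-closure Hodge weight `S' = σ_ψ • S`
    calc K' ⊓ Module.End.eigenspace (T.baseChange ℂ) μ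
        ≤ Module.End.eigenspace (T.baseChange ℂ) μ := inf_le_right
      _ = U.weightSpace F Θ S' (2 * p) := by rw [← hS', eigenspace_eq_weightSpace_at h29 hM hinj S']
      _ ≤ (U.hodge (U.cmProd F Θ) (2 * p)).piece p p :=
          weightSpace_le_piece_of_isHodgeWeightC_of_weightHodgeAt h30 (hSS' ▸ isHodgeWeightC_permWeight hS _)
  -- (1) the RATIONAL subspace `ker Q` consists of Hodge classes
  have hK : LinearMap.ker Q ≤ U.hodgeClassesOf (U.cmProd F Θ) p := by
    intro v hv
    have hvC : ofRat v ∈ K' := by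
      rw [hK', LinearMap.mem_ker, ofRat_apply, LinearMap.baseChange_tmul, LinearMap.mem_ker.mp hv,
        TensorProduct.tmul_zero]
    change ofRat v ∈ (U.hodge (U.cmProd F Θ) (2 * p)).F p
    exact HodgeStructure.piece_le_F _ _ _ (hK'le hvC)
  -- (2) `V_S ⊆ ker Q_ℂ = (ker Q) ⊗ ℂ ⊆ B ⊗ ℂ`
  have hχy : (χ.map (algebraMap ℚ ℂ)).eval (y : ℂ) = 0 := by
    have h : ((y : galoisClosure (Fin (n + 1) → (F : Type))) : ℂ) =
        algebraMap (galoisClosure (Fin (n + 1) → (F : Type))) ℂ y := rfl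
    rw [eval_map, ← aeval_def, h, aeval_algebraMap_apply, hχ, minpoly.aeval, map_zero]
  intro x hx
  have hxK : x ∈ LinearMap.ker (Q.baseChange ℂ) := by
    rw [LinearMap.mem_ker, hQC, aeval_apply_of_mem_eigenspace (weightSpace_le_eigenspace hM (2 * p) S hx),
      hy, hχy, zero_smul]
  rw [ker_baseChange_eq] at hxK
  exact Submodule.baseChange_mono ℂ hK hxK

/-! ### The `⊆` inclusion and the equality with M29 AND M30 in degree `2p` only (any CM field) -/

/-- The complexified Hodge classes lie in the sum of the weight spaces they meet — M29 in degree `2p` only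
(`baseChange_hodgeClassesOf_le`, PohlmannSpan.lean, verbatim with the `_at` eigenspace lemmas). -/
theorem baseChange_hodgeClassesOf_le_at (M : U.ModelAxioms) {p : ℕ} (h29 : U.Fact_weightSpanAt (2 * p))
    (hM : ∀ i, U.IsFactorAct F Θ (j i) (a i : F) (Mi i)) (hinj : Function.Injective (sepVal j a c)) :
    (U.hodgeClassesOf (U.cmProd F Θ) p).baseChange ℂ ≤
      ⨆ (S : Fin (n + 1) → Finset ((F : Type) →+* ℂ))
        (_ : (U.hodgeClassesOf (U.cmProd F Θ) p).baseChange ℂ ⊓ U.weightSpace F Θ S (2 * p) ≠ ⊥),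
        U.weightSpace F Θ S (2 * p) := by
  set B := U.hodgeClassesOf (U.cmProd F Θ) p
  set T := U.sepOp c Mi (2 * p)
  have hB : ∀ v ∈ B, T v ∈ B := fun v hv => sepOp_mem_hodgeClassesOf M c Mi p hv
  have hBC : ∀ x ∈ B.baseChange ℂ, T.baseChange ℂ x ∈ B.baseChange ℂ :=
    fun x hx => baseChange_mem_baseChange_of_mem T hB hx
  have hdec : B.baseChange ℂ = ⨆ μ, B.baseChange ℂ ⊓ Module.End.eigenspace (T.baseChange ℂ) μ := by
    have h := Submodule.inf_iSup_genEigenspace (p := B.baseChange ℂ) (f := T.baseChange ℂ) hBC 1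
    rw [iSup_eigenspace_eq_top_at h29 hM, inf_top_eq] at h
    exact h
  refine hdec.le.trans (iSup_le fun μ => ?_)
  by_cases hμ : B.baseChange ℂ ⊓ Module.End.eigenspace (T.baseChange ℂ) μ = ⊥
  · rw [hμ]; exact bot_le
  have hμ' : Module.End.eigenspace (T.baseChange ℂ) μ ≠ ⊥ :=
    fun h => hμ (eq_bot_iff.mpr (inf_le_right.trans h.le))
  obtain ⟨S, rfl⟩ := exists_sepVal_eq_at h29 hM hμ'
  rw [eigenspace_eq_weightSpace_at h29 hM hinj S] at hμ ⊢
  exact le_iSup₂_of_le S hμ inf_le_right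

/-- `S ∈ T_B` iff `λ(S)` is a root of the rational characteristic polynomial of `T|_B` — M29 in degree `2p` only. -/
theorem meets_iff_isRoot_at (M : U.ModelAxioms) {p : ℕ} (h29 : U.Fact_weightSpanAt (2 * p))
    (hM : ∀ i, U.IsFactorAct F Θ (j i) (a i : F) (Mi i)) (hinj : Function.Injective (sepVal j a c))
    (S : Fin (n + 1) → Finset ((F : Type) →+* ℂ)) :
    (U.hodgeClassesOf (U.cmProd F Θ) p).baseChange ℂ ⊓ U.weightSpace F Θ S (2 * p) ≠ ⊥ ↔
      (((U.sepOp c Mi (2 * p)).restrict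
          (fun _ hv => sepOp_mem_hodgeClassesOf M c Mi p hv)).charpoly.map (algebraMap ℚ ℂ)).IsRoot
        (sepVal j a c S) := by
  rw [← exists_eigenvector_mem_baseChange_iff, Submodule.ne_bot_iff]
  constructor
  · rintro ⟨x, hx, hx0⟩
    obtain ⟨hxB, hxS⟩ := Submodule.mem_inf.mp hx
    refine ⟨x, hxB, hx0, ?_⟩
    rw [← Module.End.mem_eigenspace_iff]
    exact weightSpace_le_eigenspace hM (2 * p) S hxS
  · rintro ⟨x, hxB, hx0, hx⟩
    refine ⟨x, Submodule.mem_inf.mpr ⟨hxB, ?_⟩, hx0⟩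
    rw [← eigenspace_eq_weightSpace_at h29 hM hinj S, Module.End.mem_eigenspace_iff]
    exact hx

/-- `T_B` is stable under `Gal(E^c/ℚ)` — any CM field, M29 in degree `2p` only (`meets_permWeight_galTOf` verbatim). -/
theorem meets_permWeight_galTOf_at (M : U.ModelAxioms) {p : ℕ} (h29 : U.Fact_weightSpanAt (2 * p))
    (hM : ∀ i, U.IsFactorAct F Θ (j i) (a i : F) (Mi i)) (hinj : Function.Injective (sepVal j a c))
    {S : Fin (n + 1) → Finset ((F : Type) →+* ℂ)}
    (hS : (U.hodgeClassesOf (U.cmProd F Θ) p).baseChange ℂ ⊓ U.weightSpace F Θ S (2 * p) ≠ ⊥)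
    (σ : galoisClosure (Fin (n + 1) → (F : Type)) ≃ₐ[ℚ] galoisClosure (Fin (n + 1) → (F : Type))) :
    (U.hodgeClassesOf (U.cmProd F Θ) p).baseChange ℂ ⊓ U.weightSpace F Θ (permWeight (galTOf σ).1 S) (2 * p) ≠ ⊥ := by
  obtain ⟨y, hy, hσy, -⟩ := exists_sepVal_eq_closure j a c S
  rw [meets_iff_isRoot_at M h29 hM hinj] at hS ⊢
  rw [hσy σ]
  rw [hy] at hS
  exact isRoot_algHom_of_isRoot _
    ((galoisClosure (Fin (n + 1) → (F : Type))).val.comp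
      (σ : galoisClosure (Fin (n + 1) → (F : Type)) →ₐ[ℚ] galoisClosure (Fin (n + 1) → (F : Type)))) hS

/-- Every weight met by `B^p ⊗ ℂ` is a Galois-closure Hodge weight — M29 and M30 in degree `2p` only
(`isHodgeWeightC_of_meetsAt`, AnyCMFieldNoN4.lean, verbatim). -/
theorem isHodgeWeightC_of_meets_at (M : U.ModelAxioms) {p : ℕ} (h29 : U.Fact_weightSpanAt (2 * p))
    (h30 : U.Fact_weightHodgeAt (2 * p))
    (hM : ∀ i, U.IsFactorAct F Θ (j i) (a i : F) (Mi i)) (hinj : Function.Injective (sepVal j a c))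
    {S : Fin (n + 1) → Finset ((F : Type) →+* ℂ)}
    (hS : (U.hodgeClassesOf (U.cmProd F Θ) p).baseChange ℂ ⊓ U.weightSpace F Θ S (2 * p) ≠ ⊥) :
    IsHodgeWeightC Θ p S := by
  refine ⟨?_, fun σ => ?_⟩
  · obtain ⟨hp, hq⟩ := types_of_meetsAt p h30 hS
    have hsum : (∑ j, ∑ s ∈ S j, ind (Θ j) s) + (∑ j, ∑ s ∈ S j, (1 - ind (Θ j) s)) =
        ((∑ j, (S j).card : ℕ) : ℤ) := by
      rw [← Finset.sum_add_distrib, Nat.cast_sum]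
      refine Finset.sum_congr rfl fun j _ => ?_
      rw [← Finset.sum_add_distrib, Finset.sum_congr rfl fun s _ => add_sub_cancel (ind (Θ j) s) 1]
      simp
    rw [hp, hq] at hsum
    have : ((∑ j, (S j).card : ℕ) : ℤ) = ((2 * p : ℕ) : ℤ) := by rw [← hsum]; push_cast; ring
    exact_mod_cast this
  · have h := (types_of_meetsAt p h30 (meets_permWeight_galTOf_at M h29 hM hinj hS σ)).1
    rw [sum_sum_permWeight (galTOf σ).1 S fun j t => ind (Θ j) t] at h
    simpa only [galTOf_apply] using h

/-- `B^p ⊗ ℂ ≤ ⨆_{S : IsHodgeWeightC} V_S` — M29 and M30 in degree `2p` only. -/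
theorem baseChange_hodgeClassesOf_le_iSupC_at (M : U.ModelAxioms) {p : ℕ} (h29 : U.Fact_weightSpanAt (2 * p))
    (h30 : U.Fact_weightHodgeAt (2 * p))
    (hM : ∀ i, U.IsFactorAct F Θ (j i) (a i : F) (Mi i)) (hinj : Function.Injective (sepVal j a c)) :
    (U.hodgeClassesOf (U.cmProd F Θ) p).baseChange ℂ ≤
      ⨆ (S : Fin (n + 1) → Finset ((F : Type) →+* ℂ)) (_ : IsHodgeWeightC Θ p S), U.weightSpace F Θ S (2 * p) :=
  (baseChange_hodgeClassesOf_le_at M h29 hM hinj).trans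
    (iSup₂_le fun S hS => le_iSup₂_of_le S (isHodgeWeightC_of_meets_at M h29 h30 hM hinj hS) le_rfl)

/-- **Pohlmann's theorem (equality form) with a chosen separating family, any CM field, M29 AND M30 in degree `2p` only.** -/
theorem baseChange_hodgeClassesOf_eq_iSupC_at (M : U.ModelAxioms) {p : ℕ} (h29 : U.Fact_weightSpanAt (2 * p))
    (h30 : U.Fact_weightHodgeAt (2 * p))
    (hM : ∀ i, U.IsFactorAct F Θ (j i) (a i : F) (Mi i)) (hinj : Function.Injective (sepVal j a c)) :
    (U.hodgeClassesOf (U.cmProd F Θ) p).baseChange ℂ =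
      ⨆ (S : Fin (n + 1) → Finset ((F : Type) →+* ℂ)) (_ : IsHodgeWeightC Θ p S), U.weightSpace F Θ S (2 * p) :=
  le_antisymm (baseChange_hodgeClassesOf_le_iSupC_at M h29 h30 hM hinj)
    (iSup₂_le fun _ hS => weightSpace_le_baseChange_hodgeClassesOf_C_at h29 h30 hM hinj hS)

end AnyF

/-! ## §3 The pair lemma with M29 and M30 in degree 2 only -/

section Pairs

variable {F : CMField} {n : ℕ} {Θ : Fin (n + 1) → CMType F}
  (x : (j : Fin (n + 1)) → ((F : Type) →+* ℂ) → U.CohC (U.cmAV F (Θ j)) 1)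

/-- **Complementary pairs of eigen-classes cup to algebraic divisor classes — M29 AND M30 in degree 2 only** (the proof of
`cupC_fvec_mem_algC_of_weightHodgeAt`, StubTree/Qw8NoN4.lean, verbatim over `weightSpace_le_baseChange_hodgeClassesOf_C_at`). -/
theorem cupC_fvec_mem_algC_at (M : U.ModelAxioms) (h29 : U.Fact_weightSpanAt (2 * 1))
    (h30 : U.Fact_weightHodgeAt (2 * 1)) (hx : ∀ j τ, x j τ ∈ U.eigenLine F (Θ j) τ)
    (a b : Fin (n + 1) × ((F : Type) →+* ℂ)) (hτ : pullType (Θ b.1) b.2 = barCM (pullType (Θ a.1) a.2)) :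
    U.cupC (U.cmProd F Θ) 1 1 (U.fvec x a) (U.fvec x b) ∈ U.algC (U.cmProd F Θ) 1 := by
  have hab : a ≠ b := by
    rintro rfl
    exact barCM_ne_self _ hτ.symm
  rw [← fmono_pair]
  have hW : U.fmono x 1 ![a, b] ∈ U.weightSpace F Θ (wtOf 1 ![a, b]) (2 * 1) :=
    (U.mem_weightSpace_iff F Θ _ _ _).2 (isWeightVector_fmono x M hx 1 ![a, b] (injective_vecPair hab))
  -- a separating family and factor-wise multiplications (as in `baseChange_hodgeClassesOf_eq_iSup`)
  obtain ⟨j, a', c, hinj⟩ := exists_separating_family (F := (F : Type)) n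
  choose Mi hMi using fun i => exists_isFactorAct M F Θ (j i) (a' i)
  have hinj' : Function.Injective (sepVal j a' c) := hinj
  have hB : U.fmono x 1 ![a, b] ∈ (U.hodgeClassesOf (U.cmProd F Θ) 1).baseChange ℂ :=
    weightSpace_le_baseChange_hodgeClassesOf_C_at h29 h30 hMi hinj'
      (isHodgeWeight_wtOf_pair a b hab hτ).isHodgeWeightC hW
  exact Submodule.baseChange_mono ℂ (M.lefschetz11 _) hB

end Pairs

/-! ## §4 `Qw8MilnePos` from `ModelAxioms`, N1, N2, F4, F5 — no degree-zero fact -/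

section Milne

variable {F : CMField} {n : ℕ} {Θ : Fin (n + 1) → CMType F}

/-- **Weight spaces with vanishing Lefschetz character are algebraic** (positive degree `k + 1 = 2(m+1)`), from
`ModelAxioms`, N1, N2, F4, F5 ONLY — the proof of `weightSpace_le_algC_of_lefChar_eq_zero₃/₄` verbatim with
M29 in degree 2 := `fact_weightSpanAt_succ M hN1 1` and M30 in degree 2 := `weightHodgeAt_succ_of_facts M hN1 hN2 1`. -/
theorem weightSpace_le_algC_of_lefChar_eq_zero₅ [IsGalois ℚ F] (M : U.ModelAxioms) (hN1 : U.Fact_cupExterior)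
    (hN2 : U.Fact_cup_hodge) (h4 : U.Fact_cupAlg) (h5 : U.Fact_cupAssoc) (m k : ℕ)
    (hk : k + 1 = 2 * (m + 1)) {S : Fin (n + 1) → Finset ((F : Type) →+* ℂ)} (hS : lefChar Θ S = 0) :
    U.weightSpace F Θ S (k + 1) ≤ (U.algC (U.cmProd F Θ) (m + 1)).comap (U.castC (U.cmProd F Θ) hk).toLinearMap := by
  have h29 : U.Fact_weightSpanAt (2 * 1) := fact_weightSpanAt_succ M hN1 1
  have h30 : U.Fact_weightHodgeAt (2 * 1) := weightHodgeAt_succ_of_facts M hN1 hN2 1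
  refine weightSpace_le_of_fmono_mem M hN1 k S _ fun x hx p hp hpS => ?_
  rw [Submodule.mem_comap]
  show U.castC _ hk (U.cupPowC (U.cmProd F Θ) k (U.fvec x ∘ p)) ∈ U.algC (U.cmProd F Θ) (m + 1)
  refine castC_cupPowC_mem_algC barCM h4 h5 (fun k => hN1 F n Θ k) (fun Ψ => barCM_barCM Ψ) barCM_ne_self
    m k hk (U.fvec x ∘ p) (fun i => pullType (Θ (p i).1) (p i).2) ?_ ?_
  · intro i l hτ
    exact cupC_fvec_mem_algC_at x M h29 h30 hx (p i) (p l) hτ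
  · intro Ψ
    have hb := lefChar_eq_zero_balanced Θ S hS Ψ
    have hb' : (∑ j, ∑ s ∈ S j, if pullType (Θ j) s = Ψ then (1 : ℤ) else 0) =
        ∑ j, ∑ s ∈ S j, if pullType (Θ j) s = barCM Ψ then (1 : ℤ) else 0 := by
      have h' := congrArg (Nat.cast : ℕ → ℤ) hb
      simp only [Nat.cast_sum, Finset.natCast_card_filter] at h'
      convert h' using 3
    rw [← hpS, ← sum_eq_sum_wtOf p hp (fun j s => if pullType (Θ j) s = Ψ then (1 : ℤ) else 0),
      ← sum_eq_sum_wtOf p hp (fun j s => if pullType (Θ j) s = barCM Ψ then (1 : ℤ) else 0)] at hb'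
    convert hb' using 3

end Milne


-- port_pkg: scope closed for this part
end Universe
end HodgeCM
end
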